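import Literature.Analysis.OperatorTheory.KreinStewartDefs

/-!
# Kreĭn–Stewart definitization: forms with finitely many negative squares

Elementary lemmas on Hermitian forms `B` with at most `κ` negative squares
(`KreinStewart.NegSqLEOn`): pull-backs, the basic "one negative square less on `e^⊥`" steps for a
strictly negative vector `e` and for an isotropic vector outside the radical (hyperbolic-plane
argument), and the transfer of `¬ NegSqLE` to a complement. See `KreinStewartDefs` for the
overview and sources (Stewart 1972, §1–§3).
-/

open scoped ComplexConjugate
open Module

namespace Literature.Analysis.OperatorTheory.KreinStewart

variable {V : Type*} [AddCommGroup V] [Module ℂ V]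

section Basics

variable (B : HForm V)

/-- Expansion of `B` on a linear combination. [folklore] -/
theorem apply_sum_smul {ι : Type*} (s : Finset ι) (w : ι → ℂ) (u : ι → V) (y : V) :
    B (∑ a ∈ s, w a • u a) y = ∑ a ∈ s, conj (w a) * B (u a) y := by
  rw [LinearMap.map_sum₂]
  refine Finset.sum_congr rfl fun a _ => ?_
  rw [LinearMap.map_smulₛₗ₂, smul_eq_mul]

/-- Expansion of `B` on a linear combination (second argument). [folklore] -/
theorem apply_right_sum_smul {ι : Type*} (s : Finset ι) (w : ι → ℂ) (u : ι → V) (x : V) :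
    B x (∑ a ∈ s, w a • u a) = ∑ a ∈ s, w a * B x (u a) := by
  rw [map_sum]
  refine Finset.sum_congr rfl fun a _ => ?_
  rw [map_smul, smul_eq_mul]

variable {B}

/-- For a Hermitian form, `B x x` is real. [folklore] -/
theorem apply_self_im (hB : B.IsSymm) (x : V) : (B x x).im = 0 := by
  have h := hB.eq x x
  exact Complex.conj_eq_iff_im.mp h

/-- For a Hermitian form, `B x x = (B x x).re`. [folklore] -/
theorem apply_self_eq_re (hB : B.IsSymm) (x : V) : B x x = ((B x x).re : ℂ) := by
  apply Complex.ext
  · simp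
  · simp [apply_self_im hB x]

/-- Hermitian symmetry. [folklore] -/
theorem apply_comm (hB : B.IsSymm) (x y : V) : B y x = conj (B x y) := (hB.eq x y).symm

/-- Orthogonality is symmetric. [folklore] -/
theorem apply_eq_zero_comm (hB : B.IsSymm) {x y : V} (h : B x y = 0) : B y x = 0 := by
  rw [apply_comm hB, h, map_zero]

/-- Expansion of `B (d + γ • g) (d + γ • g)` when `g ⊥ d`. [folklore] -/
theorem apply_add_smul_self (hB : B.IsSymm) {g d : V} (hgd : B g d = 0) (γ : ℂ) :
    B (d + γ • g) (d + γ • g) = B d d + (Complex.normSq γ : ℂ) * B g g := by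
  have hdg : B d g = 0 := apply_eq_zero_comm hB hgd
  simp only [LinearMap.map_smulₛₗ₂, map_add, map_smul, LinearMap.add_apply,
    smul_eq_mul, hgd, hdg, mul_zero, add_zero, zero_add, Complex.normSq_eq_conj_mul_self]
  ring

end Basics

section NegSq

variable {B : HForm V}

/-- Monotonicity of `NegSqLEOn` in the set. [folklore] -/
theorem NegSqLEOn.mono {κ : ℕ} {S T : Set V} (h : NegSqLEOn B κ T) (hST : S ⊆ T) :
    NegSqLEOn B κ S :=
  fun u hu => h u fun a => hST (hu a)

/-- `NegSqLE` restricts to every set. [folklore] -/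
theorem NegSqLE.on {κ : ℕ} (h : NegSqLE B κ) (S : Set V) : NegSqLEOn B κ S :=
  fun u _ => h u fun _ => trivial

/-- `NegSqLEOn` pulls back along linear maps. [folklore] -/
theorem NegSqLEOn.comap {W : Type*} [AddCommGroup W] [Module ℂ W] (φ : W →ₗ[ℂ] V) {κ : ℕ}
    {S : Set V} (h : NegSqLEOn B κ S) : NegSqLEOn (pb B φ) κ (φ ⁻¹' S) := by
  intro u hu
  obtain ⟨w, hw, hpos⟩ := h (fun a => φ (u a)) hu
  refine ⟨w, hw, ?_⟩
  simpa [map_sum, map_smul] using hpos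

/-- `NegSqLE` pulls back along linear maps. [folklore] -/
theorem NegSqLE.comap {W : Type*} [AddCommGroup W] [Module ℂ W] (φ : W →ₗ[ℂ] V) {κ : ℕ}
    (h : NegSqLE B κ) : NegSqLE (pb B φ) κ :=
  fun u _ => (NegSqLEOn.comap φ h) u fun _ => trivial

/-- If `¬ NegSqLE B κ` then the space is non-trivial. [folklore] -/
theorem nontrivial_of_not_negSqLE {κ : ℕ} (h : ¬ NegSqLE B κ) : Nontrivial V := by
  by_contra hV
  rw [not_nontrivial_iff_subsingleton] at hV
  apply h
  intro u _
  refine ⟨fun _ => 1, ?_, ?_⟩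
  · intro h0
    have := congr_fun h0 0
    simp at this
  · rw [Subsingleton.elim (∑ a, (fun _ => (1 : ℂ)) a • u a) 0]
    simp

/-- With zero negative squares the form is non-negative. [folklore] -/
theorem NegSqLE.nonneg {B : HForm V} (h : NegSqLE B 0) (x : V) : 0 ≤ (B x x).re := by
  obtain ⟨w, hw, hpos⟩ := h (fun _ => x) fun _ => trivial
  have hw0 : w 0 ≠ 0 := by
    intro h0
    apply hw
    ext a
    rw [Fin.fin_one_eq_zero a, h0]
    rfl
  rw [Fin.sum_univ_succ, Fin.sum_univ_zero, add_zero, LinearMap.map_smulₛₗ₂, map_smul,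
    smul_eq_mul, smul_eq_mul, ← mul_assoc,
    ← Complex.normSq_eq_conj_mul_self, Complex.re_ofReal_mul] at hpos
  have hpos' : 0 < Complex.normSq (w 0) := Complex.normSq_pos.2 hw0
  nlinarith

/-- Core step: if `g` is a strictly negative vector, orthogonal to `u 0, …, u κ`, and `B` has at
most `κ + 1` negative squares on a set containing `g` and the `u a`, then some non-trivial
combination of the `u a` is non-negative. [folklore] -/
theorem NegSqLEOn.step (hB : B.IsSymm) {κ : ℕ} {S : Set V} (h : NegSqLEOn B (κ + 1) S)
    {g : V} (hgS : g ∈ S) (hg : (B g g).re < 0) (u : Fin (κ + 1) → V) (huS : ∀ a, u a ∈ S)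
    (hgu : ∀ a, B g (u a) = 0) :
    ∃ w : Fin (κ + 1) → ℂ, w ≠ 0 ∧ 0 ≤ (B (∑ a, w a • u a) (∑ a, w a • u a)).re := by
  obtain ⟨w', hw', hpos⟩ := h (Fin.cons g u) (fun a => by
    refine Fin.cases ?_ ?_ a
    · simpa using hgS
    · intro i; simpa using huS i)
  rw [Fin.sum_univ_succ] at hpos
  simp only [Fin.cons_zero, Fin.cons_succ] at hpos
  set β := w' 0 with hβdef
  set w : Fin (κ + 1) → ℂ := fun a => w' a.succ with hwdef
  set d := ∑ a, w a • u a with hddef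
  have hgd : B g d = 0 := by
    rw [hddef, apply_right_sum_smul]
    simp [hgu]
  have key : B (β • g + d) (β • g + d) = B d d + (Complex.normSq β : ℂ) * B g g := by
    rw [add_comm]
    exact apply_add_smul_self hB hgd β
  rw [key] at hpos
  have hre : (B d d + (Complex.normSq β : ℂ) * B g g).re
      = (B d d).re + Complex.normSq β * (B g g).re := by
    rw [Complex.add_re, Complex.re_ofReal_mul]
  rw [hre] at hpos
  by_cases hw : w = 0
  · exfalso
    have hd0 : d = 0 := by
      rw [hddef]
      simp [hw]
    have hβ : β ≠ 0 := by
      intro hβ0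
      apply hw'
      ext a
      refine Fin.cases ?_ ?_ a
      · simpa using hβ0
      · intro i
        exact congr_fun hw i
    rw [hd0] at hpos
    simp only [map_zero, Complex.zero_re, zero_add] at hpos
    have hβpos : 0 < Complex.normSq β := Complex.normSq_pos.2 hβ
    nlinarith
  · refine ⟨w, hw, ?_⟩
    have h0 : 0 ≤ Complex.normSq β := Complex.normSq_nonneg β
    nlinarith

/-- If `e` is strictly negative, `e^⊥` has one negative square less. [folklore] -/
theorem NegSqLEOn.ker_of_neg (hB : B.IsSymm) {κ : ℕ} (h : NegSqLE B (κ + 1)) {e : V}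
    (he : (B e e).re < 0) : NegSqLEOn B κ {x | B e x = 0} :=
  fun u hu => NegSqLEOn.step hB h (Set.mem_univ _) he u (fun _ => trivial) hu

/-- If `e` is isotropic but not in the radical, `e^⊥` has one negative square less
(hyperbolic-plane argument). [folklore] -/
theorem NegSqLEOn.ker_of_isotropic (hB : B.IsSymm) {κ : ℕ} (h : NegSqLE B (κ + 1)) {e f : V}
    (he : B e e = 0) (hf : B e f ≠ 0) : NegSqLEOn B κ {x | B e x = 0} := by
  intro u hu
  have hu' : ∀ a, B e (u a) = 0 := hu
  -- normalise `f` to `f₂` with `B e f₂ = 1`, `B f₂ f₂ = 0`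
  obtain ⟨f₁, hf₁, hf₁e⟩ : ∃ f₁ : V, B e f₁ = 1 ∧ B f₁ e = 1 := by
    refine ⟨(B e f)⁻¹ • f, ?_, ?_⟩
    · rw [map_smul, smul_eq_mul, inv_mul_cancel₀ hf]
    · rw [apply_comm hB, map_smul, smul_eq_mul, inv_mul_cancel₀ hf, map_one]
  obtain ⟨f₂, hef₂, hf₂e, hf₂⟩ : ∃ f₂ : V, B e f₂ = 1 ∧ B f₂ e = 1 ∧ B f₂ f₂ = 0 := by
    have hr : conj (B f₁ f₁) = B f₁ f₁ := hB.eq f₁ f₁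
    have hr2 : conj (B f₁ f₁ / 2) = B f₁ f₁ / 2 := by
      rw [map_div₀, hr, map_ofNat]
    have h1 : B e (f₁ - (B f₁ f₁ / 2) • e) = 1 := by
      rw [map_sub, map_smul, hf₁, he, smul_zero, sub_zero]
    refine ⟨f₁ - (B f₁ f₁ / 2) • e, h1, ?_, ?_⟩
    · rw [apply_comm hB, h1, map_one]
    · simp only [map_sub, map_smul, LinearMap.map_smulₛₗ₂, LinearMap.sub_apply,
        smul_eq_mul, he, hf₁, hf₁e, hr2, mul_zero, sub_zero, mul_one]
      ring
  set g : V := e - f₂ with hgdef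
  have hgg' : B g g = -2 := by
    rw [hgdef]
    simp only [map_sub, LinearMap.sub_apply, he, hef₂, hf₂e, hf₂]
    norm_num
  have hgg : (B g g).re < 0 := by
    rw [hgg']
    norm_num
  set u₂ : Fin (κ + 1) → V := fun a => u a - (B f₂ (u a)) • e with hu₂def
  have hgu₂ : ∀ a, B g (u₂ a) = 0 := by
    intro a
    simp only [hgdef, hu₂def, map_sub, LinearMap.sub_apply, map_smul,
      smul_eq_mul, he, hu' a, hf₂e]
    ring
  obtain ⟨w, hw, hpos⟩ :=
    NegSqLEOn.step hB h (Set.mem_univ _) hgg u₂ (fun _ => trivial) hgu₂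
  refine ⟨w, hw, ?_⟩
  have hsum : ∑ a, w a • u₂ a = (∑ a, w a • u a) + (-(∑ a, w a * B f₂ (u a))) • e := by
    rw [neg_smul, Finset.sum_smul, ← sub_eq_add_neg, ← Finset.sum_sub_distrib]
    refine Finset.sum_congr rfl fun a _ => ?_
    rw [hu₂def, smul_sub, smul_smul]
  have hed : B e (∑ a, w a • u a) = 0 := by
    rw [apply_right_sum_smul]
    simp [hu']
  rw [hsum, apply_add_smul_self hB hed, he, mul_zero, add_zero] at hpos
  exact hpos

/-- Transfer of `¬ NegSqLE` to a complement `E₁` of a non-negative vector `e ⊥ E₁`. [folklore] -/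
theorem not_negSqLE_of_proj (hB : B.IsSymm) {κ : ℕ} (hn : ¬ NegSqLE B κ) {e : V}
    (he : 0 ≤ (B e e).re) (E₁ : Submodule ℂ V) (hE₁ : ∀ m ∈ E₁, B e m = 0) (π : V →ₗ[ℂ] E₁)
    (hπ : ∀ x, ∃ α : ℂ, x = π x + α • e) : ¬ NegSqLE (pb B E₁.subtype) κ := by
  intro h1
  apply hn
  intro u _
  obtain ⟨w, hw, hpos⟩ := h1 (fun a => π (u a)) (fun _ => trivial)
  refine ⟨w, hw, ?_⟩
  set d := ∑ a, w a • u a with hddef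
  obtain ⟨α, hα⟩ := hπ d
  have hπd : ((π d : E₁) : V) = ∑ a, w a • (π (u a) : V) := by
    rw [hddef]
    simp [map_sum, map_smul]
  have horth : B e (π d : V) = 0 := hE₁ _ (π d).2
  have key := apply_add_smul_self hB horth α
  rw [← hα] at key
  have hval : pb B E₁.subtype (∑ a, w a • π (u a)) (∑ a, w a • π (u a))
      = B (π d : V) (π d : V) := by
    rw [pb_apply, hπd]
    simp [map_sum, map_smul]
  rw [hval] at hpos
  rw [key, Complex.add_re, Complex.re_ofReal_mul]
  have h0 : 0 ≤ Complex.normSq α := Complex.normSq_nonneg α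
  nlinarith

end NegSq

end Literature.Analysis.OperatorTheory.KreinStewart
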